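import Summits.SmoothPoincare4.SmoothPoincare4.Theses.SymplecticOrigami
import Summits.SmoothPoincare4.SmoothPoincare4.Theorems.OrigamiFoldExistence.Negative.ZeroSlack
import Literature.Topology.FourManifolds.HomotopySpheres
import Literature.Topology.FourManifolds.Morse
import Literature.Topology.FourManifolds.HomotopyS4CompactProofs
import Literature.Topology.FourManifolds.HomotopyS4OrientableProofs

/-!
# Skeleton line `round-trace-continuity` for crux `OrigamiFoldExistence` (stmt-SmoothPoincare4-7844)

LEAD COPY (prover-line-stmt-SmoothPoincare4-7844-0, 2026-08-16), reshape r1: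
* r0: `stub_foldDataTransport` CLOSED by the landed `Negative.foldData_transport` (p72874); sorries 6 → 5.
* r1: `stub_roundCreaseStandard` RESHAPED — Cerf's `Γ₄ = 0` is moved out of the stub into a BY-NAME route
  hypothesis of the composition (`hC : CerfGammaFour`, item stmt-SmoothPoincare4-8758 of this route, exactly as
  `RoundSphereIsOrigamiFold` already enters); the stub is now VERBATIM the support item `RoundCreaseStandard`
  of route EuclideanOrigami (stmt-SmoothPoincare4-10644: covering lemma + twisted-sphere packaging, no Cerf),
  so it is staffed once and closable without the XL Cerf debt.  `Unfolded.*` records, for the stub workers,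
  the stub statements with this file's local predicates unfolded (Theorems files cannot import Cruxes files)
  together with the definitional implications used to close each `stub_*` by `exact`.

Route `SymplecticOrigami`, crux r4 `OrigamiFoldExistence` (E, zero slack: every smooth homotopy
4-sphere carries the fold data of `OrigamiRung`).  Idea card `Ideas/round-trace-continuity.md`
(crux-ideate r1 k1; triage r1-1: PASS with four sharpenings), restated as the triage asks
("THE FLAT LOCUS ALREADY CLOSES — state the line that way", sharpen (1); "SILENT SCOPE — flat
mean-convex starts exist only on 3-handle-free fake balls", sharpen (2); "TYPING — TraceRung on
`Δ`, not on `punctured p`", sharpen (3)):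

* the fake ball `Δ_e = S ∖ e(B̊⁴)` of a homotopy 4-sphere `S` is studied through codimension-0
  IMMERSIONS `F : Δ_e ↬ ℝ⁴` (typed exactly as in route `EuclideanOrigami`: `e : ℝ⁴ → S` a smooth
  embedding, `F : S → ℝ⁴` a local diffeomorphism at every point outside `e(B̊⁴)`; the CREASE is the
  immersed 3-sphere `F ∘ e | S³`), i.e. through FLAT hyperkähler triples `F*θ` on `Δ_e` — the
  canonical start of the card's continuity method, on which the symplectic form `F*θ₁` with round
  trace is read off at the end;
* `stub_noOneHandles` [Kirby 4.18 for homotopy spheres; VERBATIM the crux `NoohNoOneHandles` of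
  route `NoOneHandles`, stmt-SmoothPoincare4-0378 — the scope of flat mean-convex starts made
  explicit]: every homotopy 4-sphere has a Morse function without index-1 critical points;
* `stub_meanConvexThickening` [MC-START engine, Lawson–Michelsohn]: then some immersed fake ball
  of `S` has MEAN-CONVEX crease (mean curvature vector pointing to the `Δ`-side), written
  elementarily through `fderiv` (`CreaseMeanConvexAt`: the trace of `⟪(Dg)⁻¹ D²g[w,w], u⟫ - ‖w‖²`
  over a `Dg`-orthonormal tangent frame is positive; for the round model `g = ι` (inversion) it is
  `6 - 3 = 3 = H(S³) > 0`);
* `stub_meanConvexUnwinding` [PATH, HARDEST]: such a crease unwinds to a ROUND sphere through a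
  regular homotopy of collar germs `g t` that stays mean-convex (`IsMeanConvexUnwinding`);
* `stub_flatContinuity` [MCR = the card's OPEN + CLOSED steps on the flat locus]: along such a path
  the immersion of `Δ_e` persists — openness by collar interpolation, closedness by Liu's
  compactness theorem for hyperkähler triples with mean-convex boundary framings (arXiv:2202.07151
  Thm 1.2: no `(-2)`-classes on `Δ_e` since `H₂ = 0`; the limit flat triple develops into `ℝ⁴` and
  its boundary framing fixes the crease up to rigid motion, Fine–Lotay–Singer arXiv:1603.08170 p. 5
  / Liu p. 2) — so at `t = 1` some immersed fake ball has a ROUND crease;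
* `stub_roundCreaseStandard` [the card's TraceRung on the flat locus = route EuclideanOrigami's
  `RoundCreaseStandard` without its Cerf antecedent]: a round crease makes `F` a covering of the
  round ball, `Δ_e ≅ D⁴`, `S` a twisted sphere, `S ≅ S⁴` (Cerf `Γ₄ = 0`);
* `stub_foldDataTransport`: the typed fold data transport along a diffeomorphism; with the route's
  own support item `RoundSphereIsOrigamiFold` (S⁴ is a fold, CdGP Ex. 2.3/2.6) this turns `M ≅ S⁴`
  into the crux at `M`.

`OrigamiFoldExistence_of` composes the six stubs and the route item `RoundSphereIsOrigamiFold` into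
the crux BY NAME (kernel-checked, no `sorry`; the packaging facts "homotopy S⁴ ⇒ compact /
orientable" are the PROVED tree theorems `compactSpace_of_homotopyEquiv_sphere_four_holds`,
`isOrientable_of_homotopyEquiv_sphere_four_holds`).

Why the handle hypothesis is the honest first stub (triage sharpen (2)): a flat `Δ_e` with
mean-convex (= 3-convex) boundary is a handlebody with handles of index ≤ 2 (Sha, Invent. Math. 83
(1986); J. Differential Geom. 25 (1987)), and conversely an index ≤ 2 handlebody thickens to a
mean-convex (immersed) domain (Lawson–Michelsohn, Invent. Math. 77 (1984), §3); so "some immersed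
fake ball of `S` has mean-convex crease" is EQUIVALENT to "`S` is 1-handle-free (dually
3-handle-free)" modulo theorems, and the line's own content is `stub_meanConvexUnwinding` +
`stub_flatContinuity`: a GEOMETRIC standardisation of 1-handle-free homotopy spheres (no handle
slides, no Property R).  The non-flat torsion-free hypersymplectic enlargement of the card
(Donaldson ellipticity, parity of fillings) is the reserve move for the first stub's scope and is
NOT a stub here (line card §Transfer / §Not in skeleton).

Disproof used: none — no `Disproof.lean` exists for this crux at plan time (payload path absent on
disk; `ledger crux ls` = Ideas + TRIAGE-r1-1 only); `ledger negatives --problem SmoothPoincare4` = 0;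
no `Negative/` lemma landed; dead_lines = [].  Nothing to honour or import; no stub is an instance
of a refuted statement.  Self-identified tightness (for the standing disprover): `FlatContinuity`
is FALSE WITHOUT mean-convexity along the path (4-dimensional dumbbell whose band is driven through
itself: the immersed filling collapses a slab — the line uses `H > 0` exactly at the closedness step
of STUB 4), and `RoundCreaseStandard` needs the whole crease inside ONE round sphere.
-/

noncomputable section

-- the prescribed namespace `Summit.<P>.<Sub>.…` duplicates `SmoothPoincare4` (P = Sub)
set_option linter.dupNamespace false

open scoped Manifold ContDiff Topology RealInnerProductSpace
open Set Function TopologicalSpace ContinuousMap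
open Literature.Topology.FourManifolds (HomotopySphere)
open Summit.SmoothPoincare4.SmoothPoincare4.Theses.SymplecticOrigami (OrigamiFoldExistence
  RoundSphereIsOrigamiFold CerfGammaFour)

namespace Summit.SmoothPoincare4.SmoothPoincare4.Cruxes.OrigamiFoldExistence.RoundTraceContinuity

/-- Local notation: the model space `ℝ⁴`. -/
local notation "E4" => EuclideanSpace ℝ (Fin 4)

/-- Local notation: the round 4-sphere with Mathlib's smooth structure. -/
local notation "𝕊⁴" => (Metric.sphere (0 : EuclideanSpace ℝ (Fin 5)) 1)

/-! ### Vocabulary (plain definitions over Mathlib; no new objects are posited) -/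

/-- `(e, F)` presents an IMMERSED FAKE BALL of the homotopy 4-sphere `S` (route EuclideanOrigami's
convention, items `HirschPoenaruImmersion`, `RoundCreaseStandard`): `e : ℝ⁴ → S` is a smooth
embedding and `F : S → ℝ⁴` is a local diffeomorphism at every point outside `e(B̊⁴)`, i.e. on a
neighbourhood of the fake ball `Δ_e = S ∖ e(B̊⁴)` (so `F ∘ e` is smooth with invertible derivative
on a two-sided neighbourhood of the unit sphere; its restriction to `S³` is the CREASE). -/
def IsImmersedFakeBall (S : HomotopySphere 4) (e : E4 → S.carrier) (F : S.carrier → E4) : Prop :=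
  Manifold.IsSmoothEmbedding (𝓡 4) (𝓡 4) ∞ e ∧
    ∀ x, x ∉ e '' Metric.ball (0 : E4) 1 → IsLocalDiffeomorphAt (𝓡 4) (𝓡 4) ∞ F x

/-- MEAN-CONVEXITY OF A CREASE GERM towards the outside of the unit ball. `g : ℝ⁴ → ℝ⁴` is a
collar germ (a local diffeomorphism near the unit sphere); the immersed hypersurface `g | S³` is
mean-convex at `u ∈ S³` with respect to the side `Dg(u)·u` (the image of `{‖x‖ > 1}`, which is the
`Δ`-side when `g = F ∘ e`) iff its mean-curvature VECTOR has positive component along that side.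
Elementary transcription: the linear form `ℓ(v) = ⟪(Dg u)⁻¹ v, u⟫` vanishes on the tangent space
`Dg(u)(u^⊥)` and is positive on the `Δ`-side; for a curve `γ` on `S³` with `γ(0) = u`, `γ'(0) = w`
one has `(g ∘ γ)'' = D²g(u)[w,w] + Dg(u) γ''` and `ℓ(Dg(u) γ'') = ⟪γ'', u⟫ = -‖w‖²`; so
`ℓ(H⃗) = Σᵢ (⟪(Dg u)⁻¹ D²g(u)[wᵢ,wᵢ], u⟫ - ‖wᵢ‖²)` over any tangent frame `wᵢ ⊥ u` whose image
`Dg(u) wᵢ` is orthonormal (a trace: frame-independent; such frames exist as soon as `Dg(u)` is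
invertible, which every use below guarantees, so the `∀` is never vacuous). Check on the round
model `g = ι`, `ι(x) = x/‖x‖²` (route EuclideanOrigami `RoundModel`, `F ∘ e` = inversion):
`Dι(u) = I - 2uuᵀ`, `D²ι(u)[w,w] = -2‖w‖²u`, each summand `2 - 1`, total `3 = H(S³) > 0`
(mean-convex towards the ball `ι({‖x‖ > 1})`); for `g = id` the inequality reads `3 < 0` (the
exterior of a ball is not mean-convex). Same sign convention as the tree's
`PseudoRiemannianMetric.meanCurvature` for the outward normal of the filled side ("round balls are
mean convex", `MeanConvexContractible.lean`) and as Liu / Fine–Lotay–Singer ("the mean curvature of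
the boundary of the ball in ℝ⁴ is positive", arXiv:1603.08170 p. 18). -/
def CreaseMeanConvexAt (g : E4 → E4) (u : E4) : Prop :=
  ∀ w : Fin 3 → E4, (∀ i, ⟪w i, u⟫ = 0) → Orthonormal ℝ (fun i => fderiv ℝ g u (w i)) →
    ∑ i, ‖w i‖ ^ 2 <
      ∑ i, ⟪(fderiv ℝ g u).inverse (fderiv ℝ (fun x => fderiv ℝ g x (w i)) u (w i)), u⟫

/-- A MEAN-CONVEX UNWINDING: a one-parameter family of collar germs `g t : ℝ⁴ → ℝ⁴`, jointly smooth
near `[0,1] × S³`, each a local diffeomorphism at the points of `S³` (a regular homotopy of immersed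
collars `S³ × (-δ, δ) ↬ ℝ⁴`) with MEAN-CONVEX crease towards the outer side for every `t ∈ [0,1]`,
whose final crease `g 1 | S³` lies in the round sphere of centre `c` and radius `r` (then `r > 0`
and `g 1 | S³` is a covering of it, hence a diffeomorphism onto it; mean-convexity at `t = 1` forces
the outer side to be mapped INTO the round ball). -/
def IsMeanConvexUnwinding (g : ℝ → E4 → E4) (c : E4) (r : ℝ) : Prop :=
  (∀ t ∈ Icc (0 : ℝ) 1, ∀ u : E4, ‖u‖ = 1 →
      ContDiffAt ℝ ∞ (Function.uncurry g) (t, u) ∧ Function.Bijective (fderiv ℝ (g t) u) ∧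
        CreaseMeanConvexAt (g t) u) ∧
    ∀ u : E4, ‖u‖ = 1 → dist (g 1 u) c = r

/-- MC-START at `S` (derived notion, = STUB 1 + STUB 2 at `S`; the triage's [MC-START]): some
immersed fake ball of `S` has mean-convex crease. -/
def MeanConvexStart (S : HomotopySphere 4) : Prop :=
  ∃ (e : E4 → S.carrier) (F : S.carrier → E4),
    IsImmersedFakeBall S e F ∧ ∀ u : E4, ‖u‖ = 1 → CreaseMeanConvexAt (F ∘ e) u

/-- The FOLD DATA of `OrigamiRung` / `OrigamiFoldExistence` on a manifold `M` with the summit's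
binders — VERBATIM the matrix of the crux (`OrigamiFoldExistence = ∀ M …, M ≃ₕ S⁴ → FoldData M`
definitionally; `RoundSphereIsOrigamiFold = FoldData S⁴` definitionally). -/
def FoldData (M : Type) [TopologicalSpace M] [T2Space M] [SecondCountableTopology M]
    [ChartedSpace (EuclideanSpace ℝ (Fin 4)) M] [IsManifold (𝓡 4) ∞ M] : Prop :=
  ∃ (V : Fin 2 → TopologicalSpace.Opens M) (N : Fin 2 → Type) (_ : ∀ i, TopologicalSpace (N i)) (_ : ∀ i, T2Space (N i)) (_ : ∀ i, SecondCountableTopology (N i)) (_ : ∀ i, CompactSpace (N i)) (_ : ∀ i, ConnectedSpace (N i)) (_ : ∀ i, ChartedSpace (EuclideanSpace ℝ (Fin 4)) (N i)) (_ : ∀ i, IsManifold (𝓡 4) ∞ (N i)) (s : ∀ i, Literature.Geometry.Kaehler.MForm (𝓡 4) (N i) ℝ 2) (S : Fin 2 → Type) (_ : ∀ i, TopologicalSpace (S i)) (_ : ∀ i, CompactSpace (S i)) (_ : ∀ i, ConnectedSpace (S i)) (_ : ∀ i, ChartedSpace (EuclideanSpace ℝ (Fin 2)) (S i)) (_ :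 ∀ i, IsManifold (𝓡 2) ∞ (S i)) (b : ∀ i, S i → N i) (β : ∀ i, M → N i), (Disjoint (V 0) (V 1) ∧ (∀ i, (V i : Set M).Nonempty) ∧ IsConnected ((V 0 : Set M) ∪ (V 1 : Set M))ᶜ ∧ (∃ (Z : Type) (_ : TopologicalSpace Z) (_ : ChartedSpace (EuclideanSpace ℝ (Fin 3)) Z) (_ : IsManifold (𝓡 3) ∞ Z) (z : Z → M), Manifold.IsSmoothEmbedding (𝓡 3) (𝓡 4) ∞ z ∧ Set.range z = ((V 0 : Set M) ∪ (V 1 : Set M))ᶜ)) ∧ (∀ i, Literature.Geometry.Kaehler.IsSmoothForm (s i) ∧ Literature.Geometry.Kaehler.IsClosedForm (s i) ∧ (∀ x (v : TangentSpace (𝓡 4) x), v ≠ 0 → ∃ w, s i x ![v, w] ≠ 0) ∧ Manifold.IsSmoothEmbedding (𝓡 2) (𝓡 4) ∞ (b i) ∧ (∀ y (v : TangentSpace (𝓡 2) y), v ≠ 0 → ∃ w : TangentSpace (𝓡 2) y, s i (b i y) ![mfderiv (𝓡 2) (𝓡 4) (b i) y v, mfderiv (𝓡 2) (𝓡 4)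 (b i) y w] ≠ 0) ∧ (∃ U : Set M, IsOpen U ∧ closure (V i : Set M) ⊆ U ∧ ContMDiffOn (𝓡 4) (𝓡 4) ∞ (β i) U) ∧ Set.InjOn (β i) (V i : Set M) ∧ β i '' (V i : Set M) = (Set.range (b i))ᶜ ∧ (∀ x ∈ (V i : Set M), Function.Bijective (mfderiv (𝓡 4) (𝓡 4) (β i) x)) ∧ β i '' frontier (V i : Set M) ⊆ Set.range (b i) ∧ (∀ x ∈ frontier (V i : Set M), Module.finrank ℝ (LinearMap.ker (mfderiv (𝓡 4) (𝓡 4) (β i) x).toLinearMap) = 1))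

/-! ### The six stub STATEMENTS (named `Prop`s; the registered `stub_*` theorems below restate them
verbatim, and `Registered.stub_*` are their name-keyed aliases used as the hypotheses of
`OrigamiFoldExistence_of` — the native skeleton audit admits hypotheses BY NAME; same device as
`Cruxes/MazurKaneLaw/Lines/fibre-toolkit-lp-wall-map.lean`) -/

/-- Statement of STUB 1 [no 1-handles; = `NoohNoOneHandles` of route NoOneHandles, verbatim]. -/
def NoOneHandles : Prop :=
  ∀ S : Literature.Topology.FourManifolds.HomotopySphere 4, ∃ f : S.carrier → ℝ,
    Literature.Topology.FourManifolds.IsMorse (𝓡 4) f ∧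
      Literature.Topology.FourManifolds.criticalSetOfIndex (𝓡 4) f 1 = ∅

/-- Statement of STUB 2 [mean-convex thickening]: a 1-handle-free homotopy sphere has an immersed
fake ball with mean-convex crease. -/
def MeanConvexThickening : Prop :=
  ∀ S : HomotopySphere 4,
    (∃ f : S.carrier → ℝ, Literature.Topology.FourManifolds.IsMorse (𝓡 4) f ∧
        Literature.Topology.FourManifolds.criticalSetOfIndex (𝓡 4) f 1 = ∅) →
      MeanConvexStart S

/-- Statement of STUB 3 [PATH, hardest]: the mean-convex crease of an immersed fake ball unwinds
mean-convexly to a round sphere. -/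
def MeanConvexUnwinding : Prop :=
  ∀ (S : HomotopySphere 4) (e : E4 → S.carrier) (F : S.carrier → E4),
    IsImmersedFakeBall S e F → (∀ u : E4, ‖u‖ = 1 → CreaseMeanConvexAt (F ∘ e) u) →
      ∃ (g : ℝ → E4 → E4) (c : E4) (r : ℝ), g 0 = F ∘ e ∧ IsMeanConvexUnwinding g c r

/-- Statement of STUB 4 [MCR, flat continuity principle]: along a mean-convex unwinding of its
crease the immersion of the fake ball persists, so some immersed fake ball (same `e`) has the round
final crease. -/
def FlatContinuity : Prop :=
  ∀ (S : HomotopySphere 4) (e : E4 → S.carrier) (F : S.carrier → E4) (g : ℝ → E4 → E4) (c : E4)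
    (r : ℝ), IsImmersedFakeBall S e F → g 0 = F ∘ e → IsMeanConvexUnwinding g c r →
      ∃ F₁ : S.carrier → E4, IsImmersedFakeBall S e F₁ ∧ ∀ u : E4, ‖u‖ = 1 → dist (F₁ (e u)) c = r

/-- Cerf's theorem `Γ₄ = 0` in twisted-sphere form — VERBATIM the body of the route item `CerfGammaFour`
(stmt-SmoothPoincare4-8758) and of the named fact `Literature.Topology.FourManifolds.cerf_twistedSphere_four`
(lead reshape r1: it is the antecedent of STUB 5 and a by-name hypothesis of the composition). -/
def CerfTwistedSphereFour : Prop :=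
  ∀ [Fact (Literature.Topology.FourManifolds.isSmoothEmbedding_sphereInclusion' 3)] (φ : (Metric.sphere (0 : EuclideanSpace ℝ (Fin 4)) 1) ≃ₘ⟮𝓡 3, 𝓡 3⟯ (Metric.sphere (0 : EuclideanSpace ℝ (Fin 4)) 1)) (T : Literature.Topology.FourManifolds.TwistedSphere 3 φ), Nonempty (T.carrier ≃ₘ⟮𝓡 4, 𝓡 4⟯ Metric.sphere (0 : EuclideanSpace ℝ (Fin 5)) 1)

/-- Statement of STUB 5 [round crease ⇒ standard, UNDER Γ₄ = 0] (lead reshape r1): VERBATIM the support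
item `RoundCreaseStandard` of route EuclideanOrigami (stmt-SmoothPoincare4-10644) — under Cerf's theorem in
twisted-sphere form, an immersed fake ball whose crease lies in a round sphere belongs to a standard sphere. -/
def RoundCreaseStandard : Prop :=
  (∀ [Fact (Literature.Topology.FourManifolds.isSmoothEmbedding_sphereInclusion' 3)] (φ : (Metric.sphere (0 : EuclideanSpace ℝ (Fin 4)) 1) ≃ₘ⟮𝓡 3, 𝓡 3⟯ (Metric.sphere (0 : EuclideanSpace ℝ (Fin 4)) 1)) (T : Literature.Topology.FourManifolds.TwistedSphere 3 φ), Nonempty (T.carrier ≃ₘ⟮𝓡 4, 𝓡 4⟯ Metric.sphere (0 : EuclideanSpace ℝ (Fin 5)) 1)) → ∀ (S : Literature.Topology.FourManifolds.HomotopySphere 4) (e : EuclideanSpace ℝ (Fin 4) → S.carrier) (F : S.carrier → EuclideanSpace ℝ (Fin 4)), Manifold.IsSmoothEmbedding (𝓡 4) (𝓡 4) ∞ e → (∀ x, x ∉ e '' Metric.ball (0 : EuclideanSpace ℝ (Fin 4)) 1 → IsLocalDiffeomorphAt (𝓡 4) (𝓡 4) ∞ F x) → (∃ (c : EuclideanSpace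 ℝ (Fin 4)) (r : ℝ), ∀ u : EuclideanSpace ℝ (Fin 4), ‖u‖ = 1 → dist (F (e u)) c = r) → Nonempty (S.carrier ≃ₘ⟮𝓡 4, 𝓡 4⟯ Metric.sphere (0 : EuclideanSpace ℝ (Fin 5)) 1)

/-- Statement of STUB 6 [transport]: the typed fold data transport along a diffeomorphism. -/
def FoldDataTransport : Prop :=
  ∀ (M : Type) [TopologicalSpace M] [T2Space M] [SecondCountableTopology M]
    [ChartedSpace (EuclideanSpace ℝ (Fin 4)) M] [IsManifold (𝓡 4) ∞ M]
    (M' : Type) [TopologicalSpace M'] [T2Space M'] [SecondCountableTopology M']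
    [ChartedSpace (EuclideanSpace ℝ (Fin 4)) M'] [IsManifold (𝓡 4) ∞ M'],
    Nonempty (M ≃ₘ⟮𝓡 4, 𝓡 4⟯ M') → FoldData M' → FoldData M

/-! ### The registered stubs -/

/-- STUB 1 [no 1-handles] (open-problem; SHARED verbatim with crux `NoohNoOneHandles` of route
NoOneHandles, stmt-SmoothPoincare4-0378 = Kirby Problem 4.18 specialised to homotopy spheres).
Every homotopy 4-sphere carries a Morse function without critical points of index 1 (equivalently,
with `-f`, without index 3: a handle decomposition `0 ∪ 1's ∪ 2's ∪ 4`, i.e. the fake ball is a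
2-HANDLEBODY). Here it is exactly the SCOPE of flat mean-convex starts (triage sharpen (2)): by Sha
(Invent. Math. 83 (1986); J. Differential Geom. 25 (1987)) a flat manifold with mean-convex
boundary is a handlebody of index ≤ 2, and STUB 2 is the converse construction, so this stub is
forced on the flat line, not chosen (main theorems of the two papers; not re-read this session,
searchd unavailable — quoted after Sweeney arXiv:2507.15719 p. 4). Why plausibly true: no homotopy 4-sphere is known to need
1-handles; all standardised families (Cappell–Shaneson, Akbulut–Kirby, Gompf) were presented
1-handle-free; TOP handle trading is available (Freedman). Why it might fail: an exotic (or even the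
standard!) S⁴ with a decomposition-theoretic obstruction to trading 1-handles; the only known
obstructions (Yasui) need b₂⁺ > 1. Sources: Kirby1997 Problem 4.18; GompfStipsicz1999 §5.1;
Yasui2019; Sha1986; Sha1987. Size: open-problem (staffed once, through stmt-0378). -/
theorem stub_noOneHandles :
    ∀ S : Literature.Topology.FourManifolds.HomotopySphere 4, ∃ f : S.carrier → ℝ,
      Literature.Topology.FourManifolds.IsMorse (𝓡 4) f ∧
        Literature.Topology.FourManifolds.criticalSetOfIndex (𝓡 4) f 1 = ∅ := by
  sorry

/-- STUB 2 [mean-convex thickening] (L/XL, provable in principle — Lawson–Michelsohn for immersed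
2-handlebodies). If `S` has a Morse function without index-1 critical points then, passing to `-f`
and cancelling the extra `0/1` and `3/4` pairs (one 0-handle, one 4-handle: `H₀ = H₄ = ℤ` with no
3-handles), `S = (0-handle ∪ 1-handles ∪ 2-handles) ∪ 4-handle`, and for any smooth embedding
`e : ℝ⁴ → S` the fake ball `Δ_e` is that 2-handlebody (disc theorem, Palais/Cerf). Immerse its
2-spine generically in ℝ⁴ (round 0-handle, thin straight 1-handle tubes, immersed core discs) and
take `F` = the developing immersion of a THIN regular neighbourhood: away from the attaching circles
the crease has principal curvatures `(1/ρ, 1/ρ, O(1))` on tubes and `(1/ρ₂, O(1), O(1))` on the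
2-handle slabs, so `H > 0`; at a 2-handle attaching circle the concave fillet of scale `√(ρ₂ρ₁)`
keeps `H > 0` because the profile obstruction `d(r sin ψ) ≥ -ε₀ r dr` is paid by the flange
curvature `ε₀ ≍ 1/ρ₁` of the tube / 0-handle it sits on (choose `ρ₂ ≪ ρ₁`). This is the immersed,
4-dimensional case of Lawson–Michelsohn's theorem "a compact domain with a handle decomposition into
handles of index ≤ n - 2 is isotopic to one whose boundary has positive mean curvature" (Invent.
Math. 77 (1984), §3 / Thm 1 as recorded in the tree's `MeanConvexContractible.lean` — the paper is
paywalled, acq-02463; n = 4, index ≤ 2; the tree holds the Euclidean surrounding machinery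
`Literature.Geometry.Riemannian.LawsonMichelsohn1984_surrounding_of_thinHandles`, n ≥ 5, and
Sweeney2026 Prop 1.2 for Mazur manifolds). Mean-convexity is local, so self-intersections of the
immersed spine are harmless. Why it might fail: only the corner analysis at 2-handle attaching
circles (the pure surface-of-revolution fillet from a cylinder to a FLAT flange has `H ≤ 0`
somewhere — `r sin ψ` is monotone — so the positive curvature of the flange is genuinely used).
Sources: LawsonMichelsohn1984 §3; Sweeney2026 (arXiv:2507.15719) Prop 1.2; Hirsch1959;
Poenaru1962; Milnor1965 (cancellation). Size: L (geometry) + XL (Lean: Morse ⇒ handles). -/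
theorem stub_meanConvexThickening :
    ∀ S : HomotopySphere 4,
      (∃ f : S.carrier → ℝ, Literature.Topology.FourManifolds.IsMorse (𝓡 4) f ∧
          Literature.Topology.FourManifolds.criticalSetOfIndex (𝓡 4) f 1 = ∅) →
        MeanConvexStart S := by
  sorry

/-- STUB 3 [PATH] — HARDEST, the load-bearing open statement of the line. The mean-convex crease
`F ∘ e` of an immersed fake ball is the time-0 germ of a MEAN-CONVEX UNWINDING: a jointly smooth
family of collar germs `g t`, local diffeomorphisms along `S³`, mean-convex towards the outer side for
all `t ∈ [0,1]`, ending with a crease inside a round sphere. A flexibility statement about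
mean-convex immersions `S³ ↬ ℝ⁴` in the standard Smale class (the crease of an immersed fake ball IS
Smale-standard: the clutching class of `T(Δ ∪ B⁴)` has `(p₁, e) = (0, 2)` as for S⁴ — triage r1-1),
with the extra datum that the start bounds an immersed flat homotopy ball. Why plausibly true:
Gromov's h-principle for the open, `Diff`-invariant relation `H > 0` on the OPEN manifold `S³ ∖ pt`
makes any two regularly homotopic mean-convex immersions homotopic through immersions mean-convex off
a small 3-disc, so the content is concentrated; outward fingers and tubes retract mean-convexly
(n = 1 analogue: Whitney–Graustein for locally convex curves of index 1); 2-convex embedded spheres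
in ℝⁿ⁺¹ form a path-connected space (Buzano–Haslhofer–Hershkovits arXiv:1607.05604 Main Theorem, by
mean curvature flow with surgery, marble trees). Why it might fail / what it costs: with STUB 4 it
implies that every mean-convexly immersed fake ball is `B⁴`, hence (STUBS 1–2) that every
contractible 4-dimensional 2-handlebody bounded by S³ is a ball — the Andrews–Curtis /
Akbulut–Kirby territory of `Literature.Barriers.SmoothPoincare4.StrictPropertyTwoRBarrier` (no
handle slide or Property R is used, so the barrier does not bite formally; the bet is that
mean-convex regular homotopy is a richer move set than 2-handle slides — it preserves no handle
structure — yet rigid enough for STUB 4); and even for `Δ_e ≅ B⁴` it contains the open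
path-connectedness of mean-convex (not 2-convex) spheres in ℝ⁴, where mean curvature flow has
bubble-sheet (`S¹ × ℝ²`) singularities and no surgery (Huisken–Sinestrari 2009 needs 2-convexity).
Sources: Smale1959 (Ann. Math. 69); Gromov1986 (PDR, open Diff-invariant relations);
BuzanoHaslhoferHershkovits2021 (arXiv:1607.05604, JDG 118); HuiskenSinestrari2009 (Invent. Math.
175); GompfScharlemannThompson2010 (arXiv:1103.1601); Gompf1991Killing. Size: open-problem. -/
theorem stub_meanConvexUnwinding :
    ∀ (S : HomotopySphere 4) (e : E4 → S.carrier) (F : S.carrier → E4),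
      IsImmersedFakeBall S e F → (∀ u : E4, ‖u‖ = 1 → CreaseMeanConvexAt (F ∘ e) u) →
        ∃ (g : ℝ → E4 → E4) (c : E4) (r : ℝ), g 0 = F ∘ e ∧ IsMeanConvexUnwinding g c r := by
  sorry

/-- STUB 4 [MCR] — the FLAT CONTINUITY PRINCIPLE (the card's OPEN + CLOSED on the flat locus;
triage sharpen (1); XL, the analysis is in print). Let `T = {t ∈ [0,1] : some immersion F_t of Δ_e
has collar germ F_t ∘ e = g t near S³}`; `0 ∈ T` by hypothesis. OPEN: for `t'` near `t ∈ T`,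
`g t'` is C¹-close to `g t = F_t ∘ e` near `S³`, so `ψ = (F_t ∘ e)⁻¹_loc ∘ g t'` (patchwise local
inverse, uniform by compactness) is a diffeomorphism of a collar neighbourhood close to `id`; extend
it by a cut-off and put `F_{t'} = F_t ∘ (e ψ e⁻¹)`. CLOSED: for `tₙ → t*` in `T` the flat
hyperkähler triples `Fₙ*θ` on `Δ_e` (oriented, compact, `H₂(Δ_e; ℤ) = 0` so no class of square
`-2`) have boundary framings `e_*(g tₙ)*θ|S³ → e_*(g t*)*θ|S³` smoothly, and the limit framing has
`H > 0` (mean-convexity at `t*`; uniform on `[0,1] × S³` by compactness), so by Liu's compactness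
theorem (arXiv:2202.07151 = Duke Math. J. 2024, Thm 1.2; properness Prop 4.13) a subsequence
converges in Cheeger–Gromov sense to a hyperkähler triple `ω` on `Δ_e` with `ω|∂ = γ_{t*}` EXACTLY;
`ω` is flat (smooth limit of flat), so it develops: `D : Δ_e ↬ ℝ⁴` with `D*θ = ω` (simply
connected; fix the SO(3)-ambiguity by a rotation of ℍ); the closed framing determines the boundary
metric AND second fundamental form (Fine–Lotay–Singer arXiv:1603.08170 p. 5; Liu p. 2), so
`D ∘ e|S³` and `g t*|S³` differ by a rigid motion `A` (fundamental theorem of hypersurfaces), and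
after a collar reparametrisation `A⁻¹ ∘ D` has germ `g t*`: `t* ∈ T`. Hence `1 ∈ T`. (A purely
flat proof — Cheeger–Gromov for flat manifolds with boundary: `K ≡ 0`, focal bound
`dist(·, ∂) ≤ 3/H_min`, `exp` injective below the distance to the boundary by developing, no thin
necks because `H ≤ H_max` — is an alternative to citing Liu.) The line USES `H > 0` here: without
it closedness fails (immersed dumbbell whose band is pushed through itself). Why it might fail: only
through the collar bookkeeping (sides, two-sided germs, the reparametrisation `ψ`), not the
analysis. Sources: Liu2024 (arXiv:2202.07151) Thm 1.2, Prop 4.13; FineLotaySinger2017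
(arXiv:1603.08170) §1.1, Thm 1.6; Donaldson2017 (arXiv:1708.01649) §2; Bryant2010 (thickening).
Size: XL (Liu 1.2 to be vendored as a cite fact; hyperkähler triples / closed framings are not in
the tree). -/
theorem stub_flatContinuity :
    ∀ (S : HomotopySphere 4) (e : E4 → S.carrier) (F : S.carrier → E4) (g : ℝ → E4 → E4) (c : E4)
      (r : ℝ), IsImmersedFakeBall S e F → g 0 = F ∘ e → IsMeanConvexUnwinding g c r →
        ∃ F₁ : S.carrier → E4, IsImmersedFakeBall S e F₁ ∧
          ∀ u : E4, ‖u‖ = 1 → dist (F₁ (e u)) c = r := by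
  sorry

/-- STUB 5 [round crease ⇒ S ≅ S⁴, under Cerf Γ₄ = 0] — LEAD RESHAPE r1: now VERBATIM route
EuclideanOrigami's support item `RoundCreaseStandard` (stmt-SmoothPoincare4-10644), i.e. the planner's
STUB 5 with its Cerf antecedent moved OUT of the proof obligation and INTO the statement (the composition
discharges it with the by-name route item `CerfGammaFour`, stmt-SmoothPoincare4-8758 — the tree's named fact
`Literature.Topology.FourManifolds.cerf_twistedSphere_four`, XL formal debt reduced in tree to the leaf
`cerf_pi0DiffDisc_relBoundary_three`, twice parked by fact seats; it is ROUTE debt, already an item, not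
line content).  What remains is the card's TraceRung read on the flat locus: if the crease of an immersed
fake ball lies in the round sphere `S_r(c)` then `r > 0`, `F ∘ e|S³ → S_r(c)` is a local diffeomorphism of
3-spheres hence a diffeomorphism, `F` is injective on `Δ_e` (sheet counting: EuclideanOrigami item
`CoveringLemma` stmt-SmoothPoincare4-7482, proved pattern `exists_homeomorph_image_eq_sphereEquator_holds`),
`F(Δ_e)` is the closed round ball, `Δ_e ≅ D⁴` compatibly with `e`, so `S = e(D⁴) ∪ Δ_e` is a twisted
sphere (`Literature.Topology.FourManifolds.TwistedSphere`) and the antecedent gives `S ≅ S⁴`.  Why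
plausibly true: a theorem (Palais disc theorem + covering bookkeeping).  Why it might fail: it cannot
mathematically; formally the covering-space step and the `TwistedSphere` packaging are L–XL.  Sources:
Cerf1968; Palais1960; KervaireMilnor1963; Brown1960.  Size: L–XL formal (shared with stmt-10644). -/
theorem stub_roundCreaseStandard :
    (∀ [Fact (Literature.Topology.FourManifolds.isSmoothEmbedding_sphereInclusion' 3)] (φ : (Metric.sphere (0 : EuclideanSpace ℝ (Fin 4)) 1) ≃ₘ⟮𝓡 3, 𝓡 3⟯ (Metric.sphere (0 : EuclideanSpace ℝ (Fin 4)) 1)) (T : Literature.Topology.FourManifolds.TwistedSphere 3 φ), Nonempty (T.carrier ≃ₘ⟮𝓡 4, 𝓡 4⟯ Metric.sphere (0 : EuclideanSpace ℝ (Fin 5)) 1)) → ∀ (S : Literature.Topology.FourManifolds.HomotopySphere 4) (e : EuclideanSpace ℝ (Fin 4) → S.carrier) (F : S.carrier → EuclideanSpace ℝ (Fin 4)), Manifold.IsSmoothEmbedding (𝓡 4) (𝓡 4) ∞ e → (∀ x, x ∉ e '' Metric.ball (0 : EuclideanSpace ℝ (Fin 4)) 1 → IsLocalDiffeomorphAt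 (𝓡 4) (𝓡 4) ∞ F x) → (∃ (c : EuclideanSpace ℝ (Fin 4)) (r : ℝ), ∀ u : EuclideanSpace ℝ (Fin 4), ‖u‖ = 1 → dist (F (e u)) c = r) → Nonempty (S.carrier ≃ₘ⟮𝓡 4, 𝓡 4⟯ Metric.sphere (0 : EuclideanSpace ℝ (Fin 5)) 1) := by
  sorry

/-- STUB 6 [transport] (M, provable now): the fold data of `OrigamiRung` transport along a
diffeomorphism `φ : M ≃ₘ M'` — pull back `V i ↦ φ⁻¹(V i)`, keep `(N i, s i, S i, b i)`, replace
`β i ↦ β i ∘ φ` and the fold parametrisation `z ↦ φ.symm ∘ z`; disjointness / non-emptiness /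
connectedness of the complement, `IsSmoothEmbedding`, `ContMDiffOn` on `φ⁻¹ U`, injectivity, images,
bijectivity of `mfderiv (β i ∘ φ) = mfderiv (β i) ∘ mfderiv φ` and the rank-1 kernel on the frontier
are invariant (`Diffeomorph` is a homeomorphism: `closure`/`frontier` commute with `φ⁻¹`). With the
route item `RoundSphereIsOrigamiFold = FoldData S⁴` it yields `FoldData M` from `M ≅ S⁴`. Why it
might fail: it cannot (transport of structure); the work is mfderiv chain rules under binders.
Sources: Lee2013 (Prop. 3.6, Cor. 3.7); Hirsch1976. Size: M. -/
theorem stub_foldDataTransport :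
    ∀ (M : Type) [TopologicalSpace M] [T2Space M] [SecondCountableTopology M]
      [ChartedSpace (EuclideanSpace ℝ (Fin 4)) M] [IsManifold (𝓡 4) ∞ M]
      (M' : Type) [TopologicalSpace M'] [T2Space M'] [SecondCountableTopology M']
      [ChartedSpace (EuclideanSpace ℝ (Fin 4)) M'] [IsManifold (𝓡 4) ∞ M'],
      Nonempty (M ≃ₘ⟮𝓡 4, 𝓡 4⟯ M') → FoldData M' → FoldData M := by
  intro M _ _ _ _ _ M' _ _ _ _ _ hΦ h
  obtain ⟨Φ⟩ := hΦ
  exact Summit.SmoothPoincare4.SmoothPoincare4.Theorems.OrigamiFoldExistence.Negative.foldData_transport Φ h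

/-! ### Consistency: each named statement IS its registered stub (definitionally) -/

theorem noOneHandles_holds : NoOneHandles := stub_noOneHandles
theorem meanConvexThickening_holds : MeanConvexThickening := stub_meanConvexThickening
theorem meanConvexUnwinding_holds : MeanConvexUnwinding := stub_meanConvexUnwinding
theorem flatContinuity_holds : FlatContinuity := stub_flatContinuity
theorem roundCreaseStandard_holds : RoundCreaseStandard := stub_roundCreaseStandard
theorem foldDataTransport_holds : FoldDataTransport := stub_foldDataTransport

/-! ### Name-keyed aliases of the six statements (the hypotheses of the composition) -/
namespace Registered

/-- Alias of `NoOneHandles` keyed by the registered stub name. -/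
abbrev stub_noOneHandles : Prop := NoOneHandles
/-- Alias of `MeanConvexThickening` keyed by the registered stub name. -/
abbrev stub_meanConvexThickening : Prop := MeanConvexThickening
/-- Alias of `MeanConvexUnwinding` keyed by the registered stub name. -/
abbrev stub_meanConvexUnwinding : Prop := MeanConvexUnwinding
/-- Alias of `FlatContinuity` keyed by the registered stub name. -/
abbrev stub_flatContinuity : Prop := FlatContinuity
/-- Alias of `RoundCreaseStandard` keyed by the registered stub name. -/
abbrev stub_roundCreaseStandard : Prop := RoundCreaseStandard
/-- Alias of `FoldDataTransport` keyed by the registered stub name. -/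
abbrev stub_foldDataTransport : Prop := FoldDataTransport

end Registered

/-! ### Unfolded interface for the stub workers (lead r1)

Theorems files cannot import this Cruxes file, so a landed stub states its signature with the local
predicates `IsImmersedFakeBall`, `CreaseMeanConvexAt`, `IsMeanConvexUnwinding`, `MeanConvexStart`
UNFOLDED.  The `Unfolded.*` Props below are those statements verbatim, and the `*_of_unfolded` lemmas
(all `fun h => h`: definitional) are how the registered `stub_*` above get closed by `exact`. -/
namespace Unfolded

/-- `MeanConvexThickening`, predicates unfolded. -/
def MeanConvexThickening : Prop :=
  ∀ S : HomotopySphere 4,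
    (∃ f : S.carrier → ℝ, Literature.Topology.FourManifolds.IsMorse (𝓡 4) f ∧
        Literature.Topology.FourManifolds.criticalSetOfIndex (𝓡 4) f 1 = ∅) →
      (∃ (e : E4 → S.carrier) (F : S.carrier → E4), (Manifold.IsSmoothEmbedding (𝓡 4) (𝓡 4) ∞ e ∧ ∀ x, x ∉ e '' Metric.ball (0 : E4) 1 → IsLocalDiffeomorphAt (𝓡 4) (𝓡 4) ∞ F x) ∧ ∀ u : E4, ‖u‖ = 1 → (∀ w : Fin 3 → E4, (∀ i, ⟪w i, u⟫ = 0) → Orthonormal ℝ (fun i => fderiv ℝ (F ∘ e) u (w i)) → ∑ i, ‖w i‖ ^ 2 < ∑ i, ⟪(fderiv ℝ (F ∘ e) u).inverse (fderiv ℝ (fun x => fderiv ℝ (F ∘ e) x (w i)) u (w i)), u⟫))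

/-- `MeanConvexUnwinding`, predicates unfolded. -/
def MeanConvexUnwinding : Prop :=
  ∀ (S : HomotopySphere 4) (e : E4 → S.carrier) (F : S.carrier → E4),
    (Manifold.IsSmoothEmbedding (𝓡 4) (𝓡 4) ∞ e ∧ ∀ x, x ∉ e '' Metric.ball (0 : E4) 1 → IsLocalDiffeomorphAt (𝓡 4) (𝓡 4) ∞ F x) → (∀ u : E4, ‖u‖ = 1 → (∀ w : Fin 3 → E4, (∀ i, ⟪w i, u⟫ = 0) → Orthonormal ℝ (fun i => fderiv ℝ (F ∘ e) u (w i)) → ∑ i, ‖w i‖ ^ 2 < ∑ i, ⟪(fderiv ℝ (F ∘ e) u).inverse (fderiv ℝ (fun x => fderiv ℝ (F ∘ e) x (w i)) u (w i)), u⟫)) →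
      ∃ (g : ℝ → E4 → E4) (c : E4) (r : ℝ), g 0 = F ∘ e ∧ ((∀ t ∈ Icc (0 : ℝ) 1, ∀ u : E4, ‖u‖ = 1 → ContDiffAt ℝ ∞ (Function.uncurry g) (t, u) ∧ Function.Bijective (fderiv ℝ (g t) u) ∧ (∀ w : Fin 3 → E4, (∀ i, ⟪w i, u⟫ = 0) → Orthonormal ℝ (fun i => fderiv ℝ (g t) u (w i)) → ∑ i, ‖w i‖ ^ 2 < ∑ i, ⟪(fderiv ℝ (g t) u).inverse (fderiv ℝ (fun x => fderiv ℝ (g t) x (w i)) u (w i)), u⟫)) ∧ ∀ u : E4, ‖u‖ = 1 → dist (g 1 u) c = r)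

/-- `FlatContinuity`, predicates unfolded. -/
def FlatContinuity : Prop :=
  ∀ (S : HomotopySphere 4) (e : E4 → S.carrier) (F : S.carrier → E4) (g : ℝ → E4 → E4) (c : E4)
    (r : ℝ), (Manifold.IsSmoothEmbedding (𝓡 4) (𝓡 4) ∞ e ∧ ∀ x, x ∉ e '' Metric.ball (0 : E4) 1 → IsLocalDiffeomorphAt (𝓡 4) (𝓡 4) ∞ F x) → g 0 = F ∘ e → ((∀ t ∈ Icc (0 : ℝ) 1, ∀ u : E4, ‖u‖ = 1 → ContDiffAt ℝ ∞ (Function.uncurry g) (t, u) ∧ Function.Bijective (fderiv ℝ (g t) u) ∧ (∀ w : Fin 3 → E4, (∀ i, ⟪w i, u⟫ = 0) → Orthonormal ℝ (fun i => fderiv ℝ (g t) u (w i)) → ∑ i, ‖w i‖ ^ 2 < ∑ i, ⟪(fderiv ℝ (g t) u).inverse (fderiv ℝ (fun x => fderiv ℝ (g t) x (w i)) u (w i)), u⟫)) ∧ ∀ u : E4, ‖u‖ = 1 → dist (g 1 u) c = r) →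
      ∃ F₁ : S.carrier → E4, (Manifold.IsSmoothEmbedding (𝓡 4) (𝓡 4) ∞ e ∧ ∀ x, x ∉ e '' Metric.ball (0 : E4) 1 → IsLocalDiffeomorphAt (𝓡 4) (𝓡 4) ∞ F₁ x) ∧
        ∀ u : E4, ‖u‖ = 1 → dist (F₁ (e u)) c = r

end Unfolded

/-- Definitional: the unfolded STUB 2 statement is STUB 2. -/
theorem meanConvexThickening_of_unfolded (h : Unfolded.MeanConvexThickening) : MeanConvexThickening :=
  fun S hS => h S hS

/-- Definitional: the unfolded STUB 3 statement is STUB 3. -/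
theorem meanConvexUnwinding_of_unfolded (h : Unfolded.MeanConvexUnwinding) : MeanConvexUnwinding :=
  fun S e F hF hmc => h S e F hF hmc

/-- Definitional: the unfolded STUB 4 statement is STUB 4. -/
theorem flatContinuity_of_unfolded (h : Unfolded.FlatContinuity) : FlatContinuity :=
  fun S e F g c r hF hg0 hg => h S e F g c r hF hg0 hg

/-! ### Glue (proved) -/

/-- [MC-START] from STUBS 1–2: every homotopy 4-sphere has an immersed fake ball with mean-convex
crease. -/
theorem meanConvexStart_of (h1 : NoOneHandles) (h2 : MeanConvexThickening) (S : HomotopySphere 4) :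
    MeanConvexStart S :=
  h2 S (h1 S)

/-- MC-START ⟶ PATH ⟶ MCR ⟶ round crease ⟶ `S ≅ S⁴` (under Cerf `Γ₄ = 0`), for every
`S : HomotopySphere 4`. -/
theorem nonempty_diffeomorph_sphere_of (h1 : NoOneHandles) (h2 : MeanConvexThickening)
    (h3 : MeanConvexUnwinding) (h4 : FlatContinuity) (h5 : RoundCreaseStandard)
    (hC : CerfTwistedSphereFour) (S : HomotopySphere 4) : Nonempty (S.carrier ≃ₘ⟮𝓡 4, 𝓡 4⟯ 𝕊⁴) := by
  obtain ⟨e, F, hF, hmc⟩ := meanConvexStart_of h1 h2 S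
  obtain ⟨g, c, r, hg0, hg⟩ := h3 S e F hF hmc
  obtain ⟨F₁, hF₁, hround⟩ := h4 S e F g c r hF hg0 hg
  exact h5 hC S e F₁ hF₁.1 hF₁.2 ⟨c, r, hround⟩

/-! ### The composition: the six stubs and the route item `RoundSphereIsOrigamiFold` imply the
crux, by name -/

/-- `OrigamiFoldExistence` from the five open stubs, the proved STUB 6, and the route's items
(stmt-7845) and `CerfGammaFour` (stmt-8758), by name (pure logic + the PROVED packaging theorems; no
`sorry`): a smooth `M` with `M ≃ₕ S⁴` is compact (`compactSpace_of_homotopyEquiv_sphere_four_holds`) and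
orientable (`isOrientable_of_homotopyEquiv_sphere_four_holds`), hence a `HomotopySphere 4`; the glue
gives `M ≅ S⁴`; transport the fold data of `S⁴`. -/
theorem OrigamiFoldExistence_of (h1 : Registered.stub_noOneHandles)
    (h2 : Registered.stub_meanConvexThickening) (h3 : Registered.stub_meanConvexUnwinding)
    (h4 : Registered.stub_flatContinuity) (h5 : Registered.stub_roundCreaseStandard)
    (hR : RoundSphereIsOrigamiFold) (hC : CerfGammaFour) :
    OrigamiFoldExistence := by
  intro M _ _ _ _ _ hM
  haveI : CompactSpace M :=
    Literature.Topology.FourManifolds.compactSpace_of_homotopyEquiv_sphere_four_holds M hM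
  obtain ⟨o⟩ :=
    Literature.Topology.FourManifolds.isOrientable_of_homotopyEquiv_sphere_four_holds M hM
  have hφ : Nonempty (M ≃ₘ⟮𝓡 4, 𝓡 4⟯ 𝕊⁴) :=
    nonempty_diffeomorph_sphere_of h1 h2 h3 h4 h5 hC ⟨M, o, ⟨hM⟩⟩
  -- STUB 6 is PROVED (r0: `Negative.foldData_transport`, p72874), so it is discharged here, not assumed
  exact foldDataTransport_holds M 𝕊⁴ hφ hR

/-- Wiring check: the registered stubs feed `OrigamiFoldExistence_of` as stated. -/
example (hR : RoundSphereIsOrigamiFold) (hC : CerfGammaFour) : OrigamiFoldExistence :=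
  OrigamiFoldExistence_of stub_noOneHandles stub_meanConvexThickening stub_meanConvexUnwinding
    stub_flatContinuity stub_roundCreaseStandard hR hC

/-- Bookkeeping: the route item `CerfGammaFour` IS `CerfTwistedSphereFour` (definitionally). -/
example : CerfGammaFour ↔ CerfTwistedSphereFour := Iff.rfl

end Summit.SmoothPoincare4.SmoothPoincare4.Cruxes.OrigamiFoldExistence.RoundTraceContinuity

end
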